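import Summits.BirchSwinnertonDyer.BirchSwinnertonDyer.Theses.QuadraticBranchSignedControl
import HarnessLib

/-!
# Route `QuadraticBranchSignedControl` (rung K8, cell `bsd-potss`): the `Assembly` item
# (stmt-BirchSwinnertonDyer-19121) — pure logic, PROVED

`PlusMainConjectureBranch → EtaTransportSigned → NoFiniteSubmoduleSigned → PAdicGrossZagierBranch →
PublishedInputsGss2 → Gss2Assembly → Gss2AtThree → O5SharpGss`: given the leaf's binders `W, p,
r_an ≤ 1, p ≠ 2, Addv W p, SubGss W p`, split `p = 3` (the declared residual `Gss2AtThree`) / `5 ≤ p`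
(`Nat.Prime.five_le_of_ne_two_of_ne_three`, then the load-bearing support `Gss2Assembly` fed with the
published inputs and the four cruxes). Identical in content to the route's deciding theorem `closes`
(planner g7's glue); landed as the item's own closing theorem. Seat `bsd-potss-ctrl` generation 3.
Nothing about the cruxes, the supports or the residual is asserted (they are the hypotheses).
-/

set_option autoImplicit false
set_option linter.dupNamespace false

noncomputable section

namespace Summit.BirchSwinnertonDyer.BirchSwinnertonDyer.Theorems

/-- **The K8 `Assembly` item, proved** (route `QuadraticBranchSignedControl`, item
stmt-BirchSwinnertonDyer-19121): cruxes + published inputs + the assembly support + the `p = 3`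
residual ⇒ the rung leaf `O5SharpGss`, by the case split `p = 3` / `5 ≤ p`.
[cite: Miller2011LMS, §1 and Def. 1.1] -/
theorem quadraticBranchSignedControl_assembly_proof :
    Summit.BirchSwinnertonDyer.BirchSwinnertonDyer.Theses.QuadraticBranchSignedControl.Assembly := by
  intro h₁ h₂ h₃ h₄ hP hG hR W _ _ p hp hr hp2 hadd hGss
  by_cases hp3 : p = 3
  · subst hp3
    exact hR W hr hadd hGss
  · exact hG hP h₁ h₂ h₃ h₄ W p hr (hp.out.five_le_of_ne_two_of_ne_three hp2 hp3) hadd hGss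

end Summit.BirchSwinnertonDyer.BirchSwinnertonDyer.Theorems

end
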